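import Summits.QuantumFields.YangMills.Theorems.SwapVirialDeficitToronSoftnessSharpOfTubeLaw
import Summits.QuantumFields.YangMills.Theorems.SwapVirialDeficitSwapGluedStiffnessOfSharpSectorLaplace
import HarnessLib

/-!
# ⟨24196⟩ `ToronSoftnessSharp` and ⟨24194⟩ `SwapMeanActionGap` from the TWO ANALYTIC TARGETS of the window programme:
# (P) the `∀ε` sharp periodic softness of the zero-flux SECTOR as a GIBBS-MEAN bound `b⟨F₀⟩_b ≤ 9L⁴ − 3/2 + ε` (virial road), and
# (S) the per-sector sharp two-sided Laplace laws of the σ-glued ring (Morse–Bott road, ✓`swapGluedStiffness_of_sharpSectorLaplace`)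
# (LEAD ym-line-sfw-p2 g97, free hands; cell ym-idea-1; `--supports stmt-QuantumFields-24196`)

WHY THIS FILE.  The tree derives ⟨24196⟩ from the `∀ε` sector softness `PeriodicSoftnessEps` only THROUGH the tube volume law ⟨24497⟩
(✓`SectorMixture.toronSoftnessSharp_of_toronTubeVolumeLaw`, fcl-p3 g43), i.e. through a two-sided small-ball law with the logarithm and a power
rate — a Laplace∕Tauberian statement.  But an UPPER bound on a mean action is ONE-SIDED: the Haar-IBP ∕ Euler-field identity
`b⟨XF⟩_b = ⟨div X⟩_b` (✓`RingIBP.ring_virial_mean_bound`) gives `b⟨F₀⟩_b ≤ ½ sup div X + b⟨F₀ − ½XF₀⟩_b` for ANY field `X`, and the ⟨24141⟩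
`PeriodicSoftness` machine (resolvent field + explicit central field, ✓`FrameHessian.periodicSoftness`) already proves such a bound with SOME
`c > 0`; its central divergence budget is in fact the SHARP `18L⁴ − 3 + 12ρ′²` (✓`centralDiv_le_budget`), only the generic count `½(#ι − 4)`
(four sheet kernel vectors, ✓`fix_generic_divergence_upper`) and the closing algebra (`c = c₁/2`) are lossy.  So the natural target of the
periodic side is the GIBBS-MEAN statement (P) below, with NO reference to ⟨24497⟩.  This file wires it:

* §1 `periodicSoftnessEps_of_gibbsMeanWindow` — (P) ⟹ the `∀ε` sharp softness of `W₀ = TT.sectorWeight b (2L−1) 0 1` (✓`deficitFormZero`);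
* §2 ★★ `toronSoftnessSharp_of_periodicSoftnessEps` — the `∀ε` sector softness ⟹ ⟨24196⟩ BY NAME (the planner's «sector-mixture» composition,
  ym-idea-4 g14, with ✓`logDerivMixture`, ✓`twistedEquipartitionLower_of_sharpTwistedLaplace` ∘ ✓`sharpTwistedLaplace_holds` and the PROVED
  electric-flux suppression ✓`fluxSectorSuppression_proof` — the twist mixture costs nothing on a window);
  ★★ `toronSoftnessSharp_of_gibbsMeanWindow` — (P) ⟹ ⟨24196⟩;
* §3 ★★★ `swapMeanActionGap_of_gibbsMeanWindow_of_sharpSectorLaplace` — (P) ∧ (S) ⟹ ⟨24194⟩ `SwapMeanActionGap` BY NAME (the crux `closes`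
  consumes), via ✓`swapMeanActionGapGlue_proof` and ✓`swapGluedStiffness_of_sharpSectorLaplace` (p827608).  So the ROUTE'S residue is exactly
  (P) [one-sided virial, periodic ring] + (S) [two-sided Laplace, σ ring, per sector]; no cross-sector constant, no tube law, no Katsevich.

HONEST LABEL: REDUCTIONS (proved, sorry-free); (P) and (S) are crux-level and OPEN; ⟨24196⟩ ∕ ⟨24194⟩ ∕ ⟨24197⟩ ∕ ⟨24497⟩ OPEN; own crux ⟨22884⟩ OPEN
(blocked-on ⟨19935⟩); no rung of record or summit is proved; the Yang–Mills mass gap is NOT proved; no summit is proved by a line (R2b1 is a RECORD rung).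
THEOREMS ONLY (hypotheses inline; 0 `def`, 0 `sorry`), standard axioms.  References: [cite: MontvayMunster1994, (3.145)]; [cite: Griffiths1964];
[cite: tHooft1979]; [cite: Luscher1983, §2].
-/

set_option autoImplicit false

noncomputable section

open MeasureTheory Filter Set Function
open scoped BigOperators Topology

namespace Summit.QuantumFields.YangMills.Theorems.SwapVirialDeficit.SectorMixture

open Summit.QuantumFields.YangMills.Theorems.FemtoTransferGap
open Summit.QuantumFields.YangMills.Theorems.VirialFluxGap.RingDeficit

/-! ## §1 The Gibbs-mean form of the `∀ε` sector softness -/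

/-- ★ **(P) ⟹ `∀ε` sharp periodic SECTOR softness**: if on some window `b·⟨F₀⟩_b ≤ 9L⁴ − 3/2 + ε` (Gibbs mean of the zero-flux ring deficit under
`ringMeasure L`), then `12βL⁴ − 9L⁴ + 3/2 − ε ≤ β·(log W₀)′(β)` on the same window (✓`deficitFormZero`). [cite: MontvayMunster1994, (3.145)] -/
theorem periodicSoftnessEps_of_gibbsMeanWindow
    (hP : ∀ ε : ℝ, 0 < ε → ∃ a : ℝ, 0 < a ∧ ∃ β₀ : ℝ, ∃ L₀ : ℕ, ∀ β : ℝ, β₀ ≤ β → ∀ (L : ℕ) [NeZero L], L₀ ≤ L → (L : ℝ) ≤ β ^ a →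
      β * (∫ p, ringDeficit L (fun _ => false) p * Real.exp (-(β * ringDeficit L (fun _ => false) p)) ∂(ringMeasure L)) /
          (∫ p, Real.exp (-(β * ringDeficit L (fun _ => false) p)) ∂(ringMeasure L)) ≤ 9 * (L : ℝ) ^ 4 - 3 / 2 + ε) :
    ∀ ε : ℝ, 0 < ε → ∃ a : ℝ, 0 < a ∧ ∃ β₀ : ℝ, ∃ L₀ : ℕ, ∀ β : ℝ, β₀ ≤ β → ∀ (L : ℕ) [NeZero L], L₀ ≤ L → (L : ℝ) ≤ β ^ a →
      12 * β * (L : ℝ) ^ 4 - 9 * (L : ℝ) ^ 4 + 3 / 2 - ε ≤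
        β * deriv (fun b : ℝ => Real.log (TT.sectorWeight (L := L) b (2 * L - 1) (fun _ => false) (fun _ _ => (1 : ℝ)))) β := by
  intro ε hε
  obtain ⟨a, ha, β₀, L₀, h⟩ := hP ε hε
  refine ⟨a, ha, max β₀ 1, L₀, fun β hβ L _ hL hLa => ?_⟩
  have hβ₀ : β₀ ≤ β := (le_max_left _ _).trans hβ
  have hβpos : 0 < β := lt_of_lt_of_le one_pos ((le_max_right _ _).trans hβ)
  obtain ⟨-, -, hvir⟩ := deficitFormZero L
  rw [hvir β hβpos]
  have := h β hβ₀ L hL hLa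
  linarith

/-! ## §2 ⟨24196⟩ from the `∀ε` sector softness (sector mixture + proved flux suppression) -/

/-- ★★ **`∀ε` sharp periodic SECTOR softness ⟹ ⟨24196⟩ `ToronSoftnessSharp`**, by name.  The twisted sectors obey the lower half of equipartition
(✓`twistedEquipartitionLower_of_sharpTwistedLaplace` ∘ ✓`sharpTwistedLaplace_holds`) and carry probability `≤ β^{−a}/8` (✓`fluxSectorSuppression_proof`);
✓`logDerivMixture` turns `β(log Z)′` into the `p`-average — the planner's «sector-mixture» composition (ym-idea-4 g14) with its one open stub as
the hypothesis. [cite: MontvayMunster1994, (3.145)] [cite: Griffiths1964] [cite: tHooft1979] -/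
theorem toronSoftnessSharp_of_periodicSoftnessEps
    (h2 : ∀ ε : ℝ, 0 < ε → ∃ a : ℝ, 0 < a ∧ ∃ β₀ : ℝ, ∃ L₀ : ℕ, ∀ β : ℝ, β₀ ≤ β → ∀ (L : ℕ) [NeZero L], L₀ ≤ L → (L : ℝ) ≤ β ^ a →
      12 * β * (L : ℝ) ^ 4 - 9 * (L : ℝ) ^ 4 + 3 / 2 - ε ≤
        β * deriv (fun b : ℝ => Real.log (TT.sectorWeight (L := L) b (2 * L - 1) (fun _ => false) (fun _ _ => (1 : ℝ)))) β) :
    Summit.QuantumFields.YangMills.Theses.SwapVirialDeficit.ToronSoftnessSharp := by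
  have h1 := Summit.QuantumFields.YangMills.Theorems.FemtoTransferGap.TT.SectorSmooth.logDerivMixture
  have h3 := Summit.QuantumFields.YangMills.Theorems.VirialFluxGap.TwistedEquipartitionTwoSided.twistedEquipartitionLower_of_sharpTwistedLaplace
    Summit.QuantumFields.YangMills.Theorems.VirialFluxGap.FixSplit.sharpTwistedLaplace_holds
  have h4 := Summit.QuantumFields.YangMills.Theorems.FluxSectorLaplace.fluxSectorSuppression_proof
  intro ε hε
  obtain ⟨a₂, ha₂, β₂, L₂, hP⟩ := h2 (ε / 2) (by linarith)
  obtain ⟨a₃, ha₃, β₃, L₃, hTw⟩ := h3 (ε / 2) (by linarith)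
  obtain ⟨a₄, ha₄, β₄, L₄, hF⟩ := h4
  -- β^{-a₄} → 0
  have hev : ∀ᶠ β : ℝ in atTop, β ^ (-a₄) < 8 * ε / 21 := by
    have ht : Tendsto (fun β : ℝ => β ^ (-a₄)) atTop (𝓝 0) := tendsto_rpow_neg_atTop ha₄
    exact ht.eventually (gt_mem_nhds (by linarith))
  obtain ⟨β₅, hβ₅⟩ := Filter.eventually_atTop.mp hev
  set a : ℝ := min a₂ (min a₃ a₄) with ha_def
  have ha : 0 < a := lt_min ha₂ (lt_min ha₃ ha₄)
  refine ⟨a, ha, max (max β₂ β₃) (max (max β₄ β₅) 1), max L₂ (max L₃ L₄), ?_⟩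
  intro β hβ L _ hL hLwin
  have hβ₂ : β₂ ≤ β := le_trans (le_trans (le_max_left _ _) (le_max_left _ _)) hβ
  have hβ₃ : β₃ ≤ β := le_trans (le_trans (le_max_right _ _) (le_max_left _ _)) hβ
  have hβ₄ : β₄ ≤ β := le_trans (le_trans (le_trans (le_max_left _ _) (le_max_left _ _)) (le_max_right _ _)) hβ
  have hβ₅' : β₅ ≤ β := le_trans (le_trans (le_trans (le_max_right _ _) (le_max_left _ _)) (le_max_right _ _)) hβ
  have hβ1 : (1 : ℝ) ≤ β := le_trans (le_trans (le_max_right _ _) (le_max_right _ _)) hβ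
  have hL₂ : L₂ ≤ L := le_trans (le_max_left _ _) hL
  have hL₃ : L₃ ≤ L := le_trans (le_trans (le_max_left _ _) (le_max_right _ _)) hL
  have hL₄ : L₄ ≤ L := le_trans (le_trans (le_max_right _ _) (le_max_right _ _)) hL
  -- windows
  have hwin : ∀ a' : ℝ, a ≤ a' → (L : ℝ) ≤ β ^ a' := fun a' h =>
    le_trans hLwin (Real.rpow_le_rpow_of_exponent_le hβ1 h)
  have hLa₂ : (L : ℝ) ≤ β ^ a₂ := hwin a₂ (min_le_left _ _)
  have hLa₃ : (L : ℝ) ≤ β ^ a₃ := hwin a₃ (le_trans (min_le_right _ _) (min_le_left _ _))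
  have hLa₄ : (L : ℝ) ≤ β ^ a₄ := hwin a₄ (le_trans (min_le_right _ _) (min_le_right _ _))
  have hsmall : β ^ (-a₄) < 8 * ε / 21 := hβ₅ β hβ₅'
  -- the mixture
  obtain ⟨p, hp0, hp1, hpW, hder⟩ := h1 L β
  have hZpos : 0 < TT.physTrace L β (2 * L) :=
    ((Summit.QuantumFields.YangMills.Theorems.swapVirialDeficit_ringTraceSmooth_proof L (2 * L)).2.2 β).1
  set z0 : Fin 3 → Bool := fun _ => false with hz0
  set M : ℝ := 12 * β * (L : ℝ) ^ 4 - 9 * (L : ℝ) ^ 4 with hM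
  set d : (Fin 3 → Bool) → ℝ := fun z =>
    deriv (fun b : ℝ => Real.log (TT.sectorWeight (L := L) b (2 * L - 1) z (fun _ _ => (1 : ℝ)))) β with hd
  -- sector bounds
  have hX0 : M + 3 / 2 - ε / 2 ≤ β * d z0 := by
    have := hP β hβ₂ L hL₂ hLa₂
    simpa [hM, hd, hz0] using this
  have hXz : ∀ z, M - ε / 2 ≤ β * d z := by
    intro z
    by_cases hz : z = z0
    · subst hz; linarith
    · have := hTw β hβ₃ L hL₃ hLa₃ z (by simpa [hz0] using hz)
      simpa [hM, hd] using this
  -- flux suppression ⇒ p_z ≤ β^{-a₄}/8 for z ≠ z0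
  have hpz : ∀ z, z ≠ z0 → p z ≤ β ^ (-a₄) / 8 := by
    intro z hz
    have hWle := hF β hβ₄ L hL₄ hLa₄ z (by simpa [hz0] using hz)
    rw [hpW z] at hWle
    have : p z * 8 ≤ β ^ (-a₄) := by
      have h8Z : 0 < 8 * TT.physTrace L β (2 * L) := by positivity
      nlinarith [hWle, hZpos]
    linarith
  -- Σ_{z ≠ z0} p_z ≤ 7 β^{-a₄}/8 and p z0 ≥ 1 − that
  have hcard : (Finset.univ.erase z0).card = 7 := by
    rw [Finset.card_erase_of_mem (Finset.mem_univ _)]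
    simp
  have hsum_erase : ∑ z ∈ Finset.univ.erase z0, p z ≤ 7 * (β ^ (-a₄) / 8) := by
    have := Finset.sum_le_card_nsmul (Finset.univ.erase z0) p (β ^ (-a₄) / 8)
      (fun z hz => hpz z (Finset.ne_of_mem_erase hz))
    rw [hcard] at this
    simpa [nsmul_eq_mul] using this
  have hp0_split : p z0 + ∑ z ∈ Finset.univ.erase z0, p z = 1 := by
    rw [Finset.add_sum_erase _ _ (Finset.mem_univ z0)]; exact hp1
  have hp0_lb : 1 - 7 * (β ^ (-a₄) / 8) ≤ p z0 := by linarith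
  -- convex-combination estimate
  have hmain : (M - ε / 2) + 3 / 2 * p z0 ≤ ∑ z, p z * (β * d z) := by
    have hpt : ∀ z ∈ (Finset.univ : Finset (Fin 3 → Bool)),
        p z * (M - ε / 2) + (if z = z0 then 3 / 2 * p z else 0) ≤ p z * (β * d z) := by
      intro z _
      by_cases hz : z = z0
      · subst hz; simp only [if_true]; nlinarith [hX0, hp0 z0]
      · simp only [hz, if_false]; nlinarith [hXz z, hp0 z]
    have hS := Finset.sum_le_sum hpt
    rw [Finset.sum_add_distrib, Finset.sum_ite_eq' Finset.univ z0, if_pos (Finset.mem_univ _), ← Finset.sum_mul, hp1,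
      one_mul] at hS
    exact hS
  -- assemble
  have hrew : β * deriv (fun b : ℝ => Real.log (TT.physTrace L b (2 * L))) β = ∑ z, p z * (β * d z) := by
    rw [hder, Finset.mul_sum]
    refine Finset.sum_congr rfl fun z _ => ?_
    simp only [hd]; ring
  rw [hrew]
  have hnn : 0 ≤ β ^ (-a₄) := Real.rpow_nonneg (by linarith) _
  nlinarith [hmain, hp0_lb, hsmall, hnn]

/-- ★★ **(P) ⟹ ⟨24196⟩ `ToronSoftnessSharp`**: the Gibbs-mean window bound `b⟨F₀⟩_b ≤ 9L⁴ − 3/2 + ε` of the zero-flux ring deficit — the natural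
output of an Euler-field ∕ virial argument — gives the crux by name. [cite: Luscher1983, §2] [cite: Griffiths1964] -/
theorem toronSoftnessSharp_of_gibbsMeanWindow
    (hP : ∀ ε : ℝ, 0 < ε → ∃ a : ℝ, 0 < a ∧ ∃ β₀ : ℝ, ∃ L₀ : ℕ, ∀ β : ℝ, β₀ ≤ β → ∀ (L : ℕ) [NeZero L], L₀ ≤ L → (L : ℝ) ≤ β ^ a →
      β * (∫ p, ringDeficit L (fun _ => false) p * Real.exp (-(β * ringDeficit L (fun _ => false) p)) ∂(ringMeasure L)) /
          (∫ p, Real.exp (-(β * ringDeficit L (fun _ => false) p)) ∂(ringMeasure L)) ≤ 9 * (L : ℝ) ^ 4 - 3 / 2 + ε) :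
    Summit.QuantumFields.YangMills.Theses.SwapVirialDeficit.ToronSoftnessSharp :=
  toronSoftnessSharp_of_periodicSoftnessEps (periodicSoftnessEps_of_gibbsMeanWindow hP)

/-! ## §3 ⟨24194⟩ from the two analytic targets (P) and (S) -/

/-- ★★★ **THE ROUTE'S RESIDUE IN ONE THEOREM**: ⟨24194⟩ `SwapMeanActionGap` (the crux `closes` consumes) BY NAME from
(P) the Gibbs-mean window bound `b⟨F₀⟩_b ≤ 9L⁴ − 3/2 + ε` for the PERIODIC ring (one-sided, virial road) and
(S) the two per-sector sharp two-sided Laplace laws for the σ-GLUED ring (`z = 000, 001`, free constants `C_z(L)`, power rate; Morse–Bott road),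
via ✓`swapMeanActionGapGlue_proof`, §2 and ✓`SwapRing.swapGluedStiffness_of_sharpSectorLaplace`.  Nothing else of the route remains.
[cite: tHooft1979] [cite: Luscher1983, §2] [cite: Griffiths1964] -/
theorem swapMeanActionGap_of_gibbsMeanWindow_of_sharpSectorLaplace
    (hP : ∀ ε : ℝ, 0 < ε → ∃ a : ℝ, 0 < a ∧ ∃ β₀ : ℝ, ∃ L₀ : ℕ, ∀ β : ℝ, β₀ ≤ β → ∀ (L : ℕ) [NeZero L], L₀ ≤ L → (L : ℝ) ≤ β ^ a →
      β * (∫ p, ringDeficit L (fun _ => false) p * Real.exp (-(β * ringDeficit L (fun _ => false) p)) ∂(ringMeasure L)) /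
          (∫ p, Real.exp (-(β * ringDeficit L (fun _ => false) p)) ∂(ringMeasure L)) ≤ 9 * (L : ℝ) ^ 4 - 3 / 2 + ε)
    (hS : ∃ a : ℝ, 0 < a ∧ ∃ K : ℝ, 0 < K ∧ ∃ q : ℝ, 0 ≤ q ∧ ∃ θ : ℝ, 0 < θ ∧ θ ≤ 1 ∧ ∃ e₀ e₁ C₀ C₁ : ℕ → ℝ, ∃ β₀ : ℝ, ∃ L₀ : ℕ,
      (∀ L : ℕ, L₀ ≤ L → 9 * (L : ℝ) ^ 4 - 1 ≤ e₀ L ∧ e₀ L ≤ 9 * (L : ℝ) ^ 4 ∧ 9 * (L : ℝ) ^ 4 - 1 ≤ e₁ L ∧ e₁ L ≤ 9 * (L : ℝ) ^ 4) ∧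
      ∀ b : ℝ, β₀ ≤ b → ∀ (L : ℕ) [NeZero L], L₀ ≤ L → (L : ℝ) ≤ b ^ a →
        |Real.log (∫ P, Real.exp (-(b * SwapRing.swapRingDeficit L (fun _ => false) P)) ∂(ringMeasure L)) - (-(e₀ L) * Real.log b + C₀ L)| ≤
            K * (L : ℝ) ^ q * b ^ (-θ) ∧
        |Real.log (∫ P, Real.exp (-(b * SwapRing.swapRingDeficit L (fun k => decide (k = 2)) P)) ∂(ringMeasure L)) - (-(e₁ L) * Real.log b + C₁ L)| ≤
            K * (L : ℝ) ^ q * b ^ (-θ)) :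
    Summit.QuantumFields.YangMills.Theses.SwapVirialDeficit.SwapMeanActionGap :=
  Summit.QuantumFields.YangMills.Theorems.SwapVirialDeficit.swapMeanActionGapGlue_proof
    (toronSoftnessSharp_of_gibbsMeanWindow hP) (SwapRing.swapGluedStiffness_of_sharpSectorLaplace hS)

end Summit.QuantumFields.YangMills.Theorems.SwapVirialDeficit.SectorMixture

end
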